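import Literature.MathematicalPhysics.QuantumFieldTheory.Balaban1983to89.Node00.LargeFieldBackgroundOfRecord
import Literature.MathematicalPhysics.QuantumFieldTheory.Balaban1983to89.B12RegularClassInvariance263

/-!
# NODE 00 (definitions of record, R-side ₇, FILE 16) — the (2.12) background of a sequence in PRINT'S MULTI-SCALE CLASS `U_k({Ω_j}, ε₀)`, of record

T. Bałaban, *Convergent renormalization expansions for lattice gauge theories*, Commun. Math. Phys. **119** (1988) 243–285
[Balaban1988Convergent] = [III], (2.12) p. 256 [PDF 14], verbatim: *«A regular configuration V on 𝔅 determines the minimal orbit, i.e., the set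
of minima, of the functional U ↦ A(U) on U: U regular and M_𝔅(U) = V. (2.12) For precise definitions and the theory of this variational problem
see [15].»*; [15] = T. Bałaban, *The variational problem and background fields in renormalization group method for lattice gauge theories*,
Commun. Math. Phys. **102** (1985) 277–309 [Balaban1985Variational], p. 278 [PDF 2], verbatim: *«The space U_k({Ω_j}, ε₀) of gauge field
configurations on Ω₀ was defined in Sect. A of [6] by the conditions (2) … We consider the functional A(U) … on the space of gauge field
configurations U_k({Ω_j}, ε₀) ∩ 𝔘(𝔅_k, V) (6)»*, Thm 1 p. 279: *«there exists a minimal orbit in the space U_k({Ω_j}, B₃ε₁) ∩ 𝔘(𝔅_k, V) (8). This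
orbit is a unique critical orbit in the space (6) if B₃ε₁ ≤ ε₀ and ε₀ ≤ a₀»*; [6] = T. Bałaban, *Spaces of regular gauge field configurations on a
lattice and gauge fixing conditions*, Commun. Math. Phys. **99** (1985) 75–102 [Balaban1985RegularSpaces], (1.3) p. 77: *«Ω₀ ⊃ Ω₁ ⊃ Ω₂ ⊃ … ⊃ Ω_k,
Ω_j ⊂ T_η»* (with «we admit the case where some domains Ω_j are equal to T_η»), (1.7)–(1.8) p. 77 [PDF 3], verbatim: *«for a sequence (1.3) and a
positive number α₀ we define U_k({Ω_j}, α₀) as a set of all gauge field configurations U on T_η satisfying the conditions |U(∂p) − 1| < α₀L^{−2j}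
for p ∈ Ω_j, j = 0, 1, …, k, (1.7) or |U(∂p) − 1| < α₀η²(L^jη)^{−2} for p ⊂ Ω_j (1.8)»*, p. 77 (before (1.5)): *«If Ω ⊂ T_η then we denote by Ω
also the set of bonds … at least one end-point of b belongs to Ω. Similarly for the corresponding set of plaquettes»* (r-tree `B8Eq17ClassAkV1.plaqsOf`).

HONEST FRAMING (cell `pub-ymgap`, definer seat node00-def-R): definitions of record; nothing of Bałaban asserted ([15] Thm 1 existence ∕
uniqueness, the inductive estimates (2.7) [III] — NOT asserted: solvability stays the membership `W ∈ solvableDom …` wherever used); counts unmoved;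
not continuum ∕ OS ∕ mass-gap ∕ Clay.

LOCATED DEFECT OF RECORD №R16 (def-R g6, on def-R's own FILE 13 `Node00/LargeFieldBackgroundOfRecord`, count-neutral).  FILE 13 §1 reads «U regular»
of (2.12) as the ONE-SCALE class `regLFOfRecord F N ν K k = bgReg F N K k ν.εreg = {U | ∀ p, |U(∂p) − 1| < εreg·η_k²}` — [I] (1.2) p. 260, the class
of the SMALL-field problem, where every Ω_j is the whole torus.  Print's class (1.7) is SCALE-DEPENDENT: a plaquette of the fine torus meeting `Ω_j`
is asked to be `α₀L^{−2j} = εreg·η_j²`-small for every `j ≤ k` with `p ∈ Ω_j` — on `Γ₀ = Ω₁ᶜ` only `εreg·η₀² = εreg`-small.  The two classes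
COINCIDE at the no-large-field sequences (`Ω_k = T`, §3 below and FILE 13 §3) and at length `0`, and DIFFER at every sequence with `Ω₁ ≠ T`: there
the scale-`0` member of the determining set prescribes `U = W₀` on the bonds sourced in `Ω₁ᶜ` (`M⁰ = id`, r12 `gammaRegion_zero`), so a datum whose
`W₀` has inside `Ω₁ᶜ` one plaquette `≥ εreg·η_k²` is OUTSIDE FILE 13's solvable set and FILE 13's `U_k(s)(𝐖)` is the junk unit configuration
there (§4, kernel: `not_mem_solvableDom_regLF_of_le_plaq`, `UbgOfRecord_eq_one_of_le_plaq`) — although [III] p. 256 admits exactly such data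
(«|∂V_{j−1} − 1| < O(L²)ε_{j−1}» on `Γ_{j−1}`).  THIS FILE types print's class and the (2.12) background of a sequence IN IT, append-only beside
FILE 13 (which stays: a settled one-scale specialisation, read by landed modules).

WHAT THIS FILE TYPES.  §1 `omegaPlaqs` (the plaquettes «p ∈ Ω_j» with `Ω₀ = T_η` under r11's `Seq.Ω_off` convention) and the class
`regMSOfRecord F N ν K k Ω` = (1.7) at the letter `α₀ = ν.εreg` (the current clause (1.9) is omitted, as in node00-def-B's `bgReg`, divergence
D-defB-1), with its relation to FILE 13's class (`regLFOfRecord ⊆ regMSOfRecord`; equality at `Ω_k = T` and at `k = 0`); §2 the (2.12) datum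
`bgMSOfRecord` and the background of a sequence `UbgMSOfRecord F N ν M g K k s` (r11's `Ubg` at that datum; TOTAL, junk `1` off the solvable set —
FILE 1 convention) with its faces; §3 the junction with FILE 13 (`UbgMSOfRecord = UbgOfRecord` at no-large-field sequences and at length `0` — so
the level-`0` pin of node00-def-T's `Record12.UbgOfRecord₁₂` composes unchanged); §4 the `Γ₀` clause in kernel: a minimiser of positive length
equals `W₀` on the bonds sourced in `Ω₁ᶜ` (any class), the two located theorems about FILE 13's class, and for the class of this file the data
regularity it reads off `Γ₀` (`εreg·η₀²`, print's `ε₀` of [15] (6)).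

DEPENDENCES: FILE 13 `Node00.LargeFieldBackgroundOfRecord` (`regLFOfRecord`, `UbgOfRecord`, faces), FILE 1 `Node00.SmallFieldChiOfRecord`
(`UminOfRecord`, `solvableDom`, `bgOfRecord`, `Stage7Numerics.εreg`), FILE 4 (`SeqOfRecord`), r11 `B14Eq218Concrete.Ubg`, r12 `B15DeterminingSets`
(`genSet`, `gammaRegion_zero`, `pts_zero`, `bondsOf`, `IsMinimizer`), `B8Eq17ClassAkV1.plaqsOf`, `B12RegularClassInvariance263.plaqSmallOn_univ_iff`, node00-def-B `bgReg`.  No instance,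
no notation, no `sorry`. [cite: Balaban1988Convergent, (2.12) p.256; Balaban1985Variational, (2),(6) p.278, Thm 1 (8) p.279; Balaban1985RegularSpaces, (1.3),(1.7)–(1.8) p.77]
-/

noncomputable section

namespace Literature.MathematicalPhysics.QuantumFieldTheory.Balaban1983to89.Node00

open Literature.MathematicalPhysics.QuantumFieldTheory.Balaban1983to89
open T4Continuum B15DeterminingSets

variable (F : T4Family) (N : ℕ) [NeZero N]

/-! ## §1  Print's class `U_k({Ω_j}, ε₀)` — [6] (1.7) p. 77 ∕ [15] (2), (6) p. 278 — of record -/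

section ClassMS

variable {P : Params}

/-- **The plaquettes «p ∈ Ω_j»** of [6] (1.7): the fine plaquettes with at least one corner in `Ω_j` (p. 77 convention, `B8Eq17ClassAkV1.plaqsOf`),
with `Ω₀ = T_η` ([6] (1.3)) — r11's sequences carry `Ω 0 = ∅` (`Seq.Ω_off`), so scale `0` is read as the whole torus here.
[cite: Balaban1985RegularSpaces, (1.3) p.77, p.77 (convention before (1.5))] -/
def omegaPlaqs (Ω : ℕ → Set (Site P 0)) (j : ℕ) : Set (Plaq P 0) :=
  if j = 0 then Set.univ else B8Eq17ClassAkV1.plaqsOf (Ω j)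

/-- At scale `0` every plaquette counts (`Ω₀ = T_η`). [cite: Balaban1985RegularSpaces, (1.3) p.77] -/
@[simp] theorem omegaPlaqs_zero (Ω : ℕ → Set (Site P 0)) : omegaPlaqs Ω 0 = Set.univ := rfl

/-- At a positive scale: the plaquettes meeting `Ω_j`. [cite: Balaban1985RegularSpaces, (1.7) p.77] -/
theorem omegaPlaqs_of_ne_zero (Ω : ℕ → Set (Site P 0)) {j : ℕ} (hj : j ≠ 0) : omegaPlaqs Ω j = B8Eq17ClassAkV1.plaqsOf (Ω j) := if_neg hj

/-- At a positive scale (successor form). [cite: Balaban1985RegularSpaces, (1.7) p.77] -/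
@[simp] theorem omegaPlaqs_succ (Ω : ℕ → Set (Site P 0)) (j : ℕ) : omegaPlaqs Ω (j + 1) = B8Eq17ClassAkV1.plaqsOf (Ω (j + 1)) :=
  if_neg (Nat.succ_ne_zero j)

/-- If `Ω_j` is the whole torus, so is its plaquette set. [cite: Balaban1985RegularSpaces, (1.3) p.77 («Ω_j = T_η»)] -/
theorem omegaPlaqs_of_univ (Ω : ℕ → Set (Site P 0)) {j : ℕ} (hΩ : Ω j = Set.univ) : omegaPlaqs Ω j = Set.univ := by
  by_cases hj : j = 0
  · subst hj; rfl
  · rw [omegaPlaqs_of_ne_zero Ω hj, hΩ, B8Eq17ClassAkV1.plaqsOf_univ]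

end ClassMS

/-- **PRINT'S REGULARITY CLASS OF (2.12), OF RECORD** — [6] (1.7): `U_k({Ω_j}, α₀) = {U | |U(∂p) − 1| < α₀L^{−2j} for p ∈ Ω_j, j = 0, …, k}` at the
letter `α₀ = ν.εreg` (`= ε₀` of [15] (6); `L^{−2j} = η_j²`, `η_j = (F.P K).eta j`); the current clause (1.9) is omitted (node00-def-B divergence D-defB-1,
as in `bgReg`). [cite: Balaban1985RegularSpaces, (1.7)–(1.8) p.77; Balaban1985Variational, (2),(6) p.278; Balaban1988Convergent, (2.12) p.256] -/
def regMSOfRecord (ν : Stage7Numerics) (K k : ℕ) (Ω : ℕ → Set (Site (F.P K) 0)) : Set (GaugeField (F.P K) 0 (SU N)) :=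
  {U | ∀ j, j ≤ k → PlaqSmallOn (omegaPlaqs Ω j) (ν.εreg * (F.P K).eta j ^ 2) U}

/-- Membership (definitional). [cite: Balaban1985RegularSpaces, (1.7) p.77 (bookkeeping)] -/
theorem mem_regMSOfRecord_iff (ν : Stage7Numerics) (K k : ℕ) (Ω : ℕ → Set (Site (F.P K) 0)) (U : GaugeField (F.P K) 0 (SU N)) :
    U ∈ regMSOfRecord F N ν K k Ω ↔ ∀ j, j ≤ k → PlaqSmallOn (omegaPlaqs Ω j) (ν.εreg * (F.P K).eta j ^ 2) U := Iff.rfl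

variable {F N}

/-- The scale-`0` clause: a member is GLOBALLY `εreg·η₀²`-small (`η₀ = 1`: `εreg`-small — print's `ε₀` of [15] (6), not `εreg·η_k²`).
[cite: Balaban1985RegularSpaces, (1.7) p.77 (j = 0)] -/
theorem plaqSmall_of_mem_regMSOfRecord {ν : Stage7Numerics} {K k : ℕ} {Ω : ℕ → Set (Site (F.P K) 0)} {U : GaugeField (F.P K) 0 (SU N)}
    (hU : U ∈ regMSOfRecord F N ν K k Ω) : PlaqSmall (ν.εreg * (F.P K).eta 0 ^ 2) U :=
  (B12RegularClassInvariance263.plaqSmallOn_univ_iff _ U).1 (by simpa only [omegaPlaqs_zero] using hU 0 (Nat.zero_le k))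

/-- The same with `η₀ = 1` evaluated. [cite: Balaban1985RegularSpaces, (1.7) p.77 (j = 0)] -/
theorem plaqSmall_of_mem_regMSOfRecord' {ν : Stage7Numerics} {K k : ℕ} {Ω : ℕ → Set (Site (F.P K) 0)} {U : GaugeField (F.P K) 0 (SU N)}
    (hU : U ∈ regMSOfRecord F N ν K k Ω) : PlaqSmall ν.εreg U := by
  simpa [Params.eta] using plaqSmall_of_mem_regMSOfRecord hU

/-- The scale-`j` clause, `1 ≤ j ≤ k`: the plaquettes meeting `Ω_j` are `εreg·η_j²`-small. [cite: Balaban1985RegularSpaces, (1.7) p.77] -/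
theorem plaqSmallOn_of_mem_regMSOfRecord {ν : Stage7Numerics} {K k : ℕ} {Ω : ℕ → Set (Site (F.P K) 0)} {U : GaugeField (F.P K) 0 (SU N)}
    (hU : U ∈ regMSOfRecord F N ν K k Ω) {j : ℕ} (hj : 1 ≤ j) (hjk : j ≤ k) :
    PlaqSmallOn (B8Eq17ClassAkV1.plaqsOf (Ω j)) (ν.εreg * (F.P K).eta j ^ 2) U := by
  simpa only [omegaPlaqs_of_ne_zero Ω (Nat.one_le_iff_ne_zero.mp hj)] using hU j hjk

/-- `η_k² ≤ η_j²` for `j ≤ k` (`η = L^{−1} ≤ 1`; bookkeeping). [cite: Balaban1987RG1, (1.1) p.260 (bookkeeping)] -/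
theorem eta_sq_le_eta_sq (K : ℕ) {j k : ℕ} (hjk : j ≤ k) : (F.P K).eta k ^ 2 ≤ (F.P K).eta j ^ 2 := by
  have h0 : (0 : ℝ) ≤ ((F.P K).L : ℝ)⁻¹ := inv_nonneg.mpr (Nat.cast_nonneg _)
  have h1 : ((F.P K).L : ℝ)⁻¹ ≤ 1 := inv_le_one_of_one_le₀ (by exact_mod_cast (F.P K).L_pos)
  have hle : (F.P K).eta k ≤ (F.P K).eta j := pow_le_pow_of_le_one h0 h1 hjk
  exact pow_le_pow_left₀ (pow_nonneg h0 k) hle 2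

/-- **FILE 13's one-scale class is INSIDE print's class** (for `0 ≤ εreg`): global `εreg·η_k²`-smallness implies every scale-`j` clause, `j ≤ k`.
[cite: Balaban1985RegularSpaces, (1.7) p.77; Balaban1987RG1, (1.2) p.260] -/
theorem regLFOfRecord_subset_regMSOfRecord (ν : Stage7Numerics) (hε : 0 ≤ ν.εreg) (K k : ℕ) (Ω : ℕ → Set (Site (F.P K) 0)) :
    regLFOfRecord F N ν K k ⊆ regMSOfRecord F N ν K k Ω := by
  intro U hU j hjk p _
  exact lt_of_lt_of_le (hU p) (mul_le_mul_of_nonneg_left (eta_sq_le_eta_sq K hjk) hε)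

/-- **At a no-large-field top scale the two classes COINCIDE**: if `Ω_k = T` (`k ≥ 1`), print's class is FILE 13's `{U | |U(∂p) − 1| < εreg·η_k²}`
(the `j = k` clause is global and dominates the lower ones). [cite: Balaban1985RegularSpaces, (1.7) p.77 («if these conditions hold for some j = l, then they hold for all j < l»)] -/
theorem regMSOfRecord_eq_regLFOfRecord_of_top (ν : Stage7Numerics) (hε : 0 ≤ ν.εreg) (K : ℕ) {k : ℕ} (Ω : ℕ → Set (Site (F.P K) 0))
    (hΩ : Ω k = Set.univ) : regMSOfRecord F N ν K k Ω = regLFOfRecord F N ν K k := by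
  refine Set.Subset.antisymm ?_ (regLFOfRecord_subset_regMSOfRecord ν hε K k Ω)
  intro U hU
  have h := hU k le_rfl
  rw [omegaPlaqs_of_univ Ω hΩ, B12RegularClassInvariance263.plaqSmallOn_univ_iff] at h
  exact h

/-- **At length `0` the two classes COINCIDE** (only the global scale-`0` clause). [cite: Balaban1985RegularSpaces, (1.7) p.77 (k = 0)] -/
theorem regMSOfRecord_zero_eq (ν : Stage7Numerics) (K : ℕ) (Ω : ℕ → Set (Site (F.P K) 0)) :
    regMSOfRecord F N ν K 0 Ω = regLFOfRecord F N ν K 0 := by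
  ext U
  rw [mem_regMSOfRecord_iff, mem_regLFOfRecord_iff]
  constructor
  · intro h
    exact (B12RegularClassInvariance263.plaqSmallOn_univ_iff _ U).1 (by simpa only [omegaPlaqs_zero] using h 0 le_rfl)
  · intro h j hj
    obtain rfl : j = 0 := Nat.le_zero.mp hj
    rw [omegaPlaqs_zero, B12RegularClassInvariance263.plaqSmallOn_univ_iff]
    exact h

variable (F N)

/-! ## §2  The (2.12) datum and the background of a sequence in print's class, of record -/

/-- **The (2.12) datum of record in print's class**: FILE 1's `bgOfRecord` along the averaging of record `avOfRecord F N K` in the class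
`regMSOfRecord … Ω` of the sequence `{Ω_j}`. [cite: Balaban1988Convergent, (2.12)–(2.13) p.256–257; Balaban1985Variational, (6) p.278] -/
def bgMSOfRecord (ν : Stage7Numerics) (K k : ℕ) (Ω : ℕ → Set (Site (F.P K) 0)) : DetBackground (F.P K) (SU N) (avOfRecord F N K) :=
  bgOfRecord (avOfRecord F N K) (regMSOfRecord F N ν K k Ω)

/-- Its solution map is FILE 1's `UminOfRecord` in print's class (definitional). [cite: Balaban1988Convergent, (2.12) p.256 (bookkeeping)] -/
theorem bgMSOfRecord_U (ν : Stage7Numerics) (K k : ℕ) (Ω : ℕ → Set (Site (F.P K) 0)) :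
    (bgMSOfRecord F N ν K k Ω).U = UminOfRecord (avOfRecord F N K) (regMSOfRecord F N ν K k Ω) := rfl

/-- Its domain is FILE 1's solvable set in print's class (definitional). [cite: Balaban1988Convergent, (2.12) p.256 (bookkeeping)] -/
theorem bgMSOfRecord_dom (ν : Stage7Numerics) (K k : ℕ) (Ω : ℕ → Set (Site (F.P K) 0)) :
    (bgMSOfRecord F N ν K k Ω).dom = solvableDom (avOfRecord F N K) (regMSOfRecord F N ν K k Ω) := rfl

/-- Its class (definitional). [cite: Balaban1985Variational, (6) p.278 (bookkeeping)] -/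
theorem bgMSOfRecord_reg (ν : Stage7Numerics) (K k : ℕ) (Ω : ℕ → Set (Site (F.P K) 0)) :
    (bgMSOfRecord F N ν K k Ω).reg = regMSOfRecord F N ν K k Ω := rfl

/-- **THE BACKGROUND FIELD OF A SEQUENCE IN PRINT'S CLASS, OF RECORD** — `U_k(s)(𝐖) = U(𝔅({Ω_j(s)}), 𝐖)`, the minimiser of (2.12) over
`U_k({Ω_j(s)}, εreg) ∩ 𝔘(𝔅_k, 𝐖)`: r11's `B14.Eq218Concrete.Ubg` at the datum `bgMSOfRecord … s.Ω`.  TOTAL (junk `1` off the solvable set, FILE 1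
convention); solvability of print-regular data is [15] Thm 1 — NOT asserted. [cite: Balaban1988Convergent, (2.12)–(2.13) p.256–257, §2 p.258; Balaban1985Variational, Thm 1 (8) p.279] -/
def UbgMSOfRecord (ν : Stage7Numerics) (M : ℕ) (g : ℕ → ℝ) (K k : ℕ) (s : SeqOfRecord F ν M g K k) :
    MSField (F.P K) (SU N) → GaugeField (F.P K) 0 (SU N) :=
  B14.Eq218Concrete.Ubg (bgMSOfRecord F N ν K k s.Ω) k s

variable {F N}

/-- Unfolding to FILE 1's solution map on `𝔅({Ω_j(s)}) = genSet s.Ω k` in print's class (definitional). [cite: Balaban1988Convergent, (2.13) p.257] -/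
theorem UbgMSOfRecord_apply (ν : Stage7Numerics) (M : ℕ) (g : ℕ → ℝ) (K k : ℕ) (s : SeqOfRecord F ν M g K k)
    (W : MSField (F.P K) (SU N)) :
    UbgMSOfRecord F N ν M g K k s W = UminOfRecord (avOfRecord F N K) (regMSOfRecord F N ν K k s.Ω) (genSet s.Ω k) W := rfl

/-- It is r11's `Ubg` at the datum of record in print's class (definitional). [cite: Balaban1988Convergent, §2 p.258] -/
theorem UbgMSOfRecord_eq_Ubg (ν : Stage7Numerics) (M : ℕ) (g : ℕ → ℝ) (K k : ℕ) (s : SeqOfRecord F ν M g K k) :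
    UbgMSOfRecord F N ν M g K k s = B14.Eq218Concrete.Ubg (bgMSOfRecord F N ν K k s.Ω) k s := rfl

/-- **THE CHARACTERISING PROPERTY on the solvable set**: `U_k(s)(𝐖)` IS a minimal configuration of (2.12) in print's class for `𝔅({Ω_j(s)})` and `𝐖`.
[cite: Balaban1988Convergent, (2.12) p.256; Balaban1985Variational, (6) p.278] -/
theorem isMinimizer_UbgMSOfRecord (ν : Stage7Numerics) (M : ℕ) (g : ℕ → ℝ) (K k : ℕ) (s : SeqOfRecord F ν M g K k)
    {W : MSField (F.P K) (SU N)} (hW : W ∈ solvableDom (avOfRecord F N K) (regMSOfRecord F N ν K k s.Ω) (genSet s.Ω k)) :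
    IsMinimizer (avOfRecord F N K) (regMSOfRecord F N ν K k s.Ω) (genSet s.Ω k) W (UbgMSOfRecord F N ν M g K k s W) :=
  B14.Eq218Concrete.isMinimizer_Ubg (bgMSOfRecord F N ν K k s.Ω) k s hW

/-- On the solvable set `U_k(s)(𝐖)` lies in print's class `U_k({Ω_j(s)}, εreg)`. [cite: Balaban1985Variational, (6),(8) p.278–279] -/
theorem UbgMSOfRecord_mem_reg (ν : Stage7Numerics) (M : ℕ) (g : ℕ → ℝ) (K k : ℕ) (s : SeqOfRecord F ν M g K k)
    {W : MSField (F.P K) (SU N)} (hW : W ∈ solvableDom (avOfRecord F N K) (regMSOfRecord F N ν K k s.Ω) (genSet s.Ω k)) :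
    UbgMSOfRecord F N ν M g K k s W ∈ regMSOfRecord F N ν K k s.Ω :=
  (isMinimizer_UbgMSOfRecord ν M g K k s hW).1

/-- On the solvable set the averages of `U_k(s)(𝐖)` agree with `𝐖` on the determining set: `M_𝔅(U_k(s)(𝐖)) = 𝐖` ((2.11)–(2.12)).
[cite: Balaban1988Convergent, (2.11)–(2.12) p.256] -/
theorem agreeOn_UbgMSOfRecord (ν : Stage7Numerics) (M : ℕ) (g : ℕ → ℝ) (K k : ℕ) (s : SeqOfRecord F ν M g K k)
    {W : MSField (F.P K) (SU N)} (hW : W ∈ solvableDom (avOfRecord F N K) (regMSOfRecord F N ν K k s.Ω) (genSet s.Ω k)) :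
    AgreeOn (genSet s.Ω k) (avgFamily (avOfRecord F N K) (UbgMSOfRecord F N ν M g K k s W)) W :=
  (isMinimizer_UbgMSOfRecord ν M g K k s hW).2.1

/-- Off the solvable set `U_k(s)(𝐖)` is the unit configuration (documented junk default of FILE 1).
[cite: Balaban1988Convergent, (2.12) p.256 (typing convention)] -/
theorem UbgMSOfRecord_of_not_mem (ν : Stage7Numerics) (M : ℕ) (g : ℕ → ℝ) (K k : ℕ) (s : SeqOfRecord F ν M g K k)
    {W : MSField (F.P K) (SU N)} (hW : W ∉ solvableDom (avOfRecord F N K) (regMSOfRecord F N ν K k s.Ω) (genSet s.Ω k)) :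
    UbgMSOfRecord F N ν M g K k s W = fun _ => 1 :=
  UminOfRecord_of_not (avOfRecord F N K) (regMSOfRecord F N ν K k s.Ω) (by rwa [mem_solvableDom_iff] at hW)

/-- On the solvable set the scale-`j` clause of print's class holds for the background: the plaquettes meeting `Ω_j(s)` are `εreg·η_j²`-small,
`1 ≤ j ≤ k` ((1.7) at the minimiser). [cite: Balaban1985RegularSpaces, (1.7) p.77; Balaban1985Variational, (8) p.279] -/
theorem plaqSmallOn_UbgMSOfRecord (ν : Stage7Numerics) (M : ℕ) (g : ℕ → ℝ) (K k : ℕ) (s : SeqOfRecord F ν M g K k)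
    {W : MSField (F.P K) (SU N)} (hW : W ∈ solvableDom (avOfRecord F N K) (regMSOfRecord F N ν K k s.Ω) (genSet s.Ω k))
    {j : ℕ} (hj : 1 ≤ j) (hjk : j ≤ k) :
    PlaqSmallOn (B8Eq17ClassAkV1.plaqsOf (s.Ω j)) (ν.εreg * (F.P K).eta j ^ 2) (UbgMSOfRecord F N ν M g K k s W) :=
  plaqSmallOn_of_mem_regMSOfRecord (UbgMSOfRecord_mem_reg ν M g K k s hW) hj hjk

/-! ## §3  The junction with FILE 13 (no large fields; length `0`) -/

/-- **At a no-large-field top scale the two backgrounds of record COINCIDE** (`Ω_k(s) = T`, `k ≥ 1`, `0 ≤ εreg`): same averaging, same determining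
set, same class (`regMSOfRecord_eq_regLFOfRecord_of_top`), same choice. [cite: Balaban1988Convergent, (2.12) p.256; Balaban1985RegularSpaces, (1.7) p.77] -/
theorem UbgMSOfRecord_eq_UbgOfRecord_of_top (ν : Stage7Numerics) (hε : 0 ≤ ν.εreg) (M : ℕ) (g : ℕ → ℝ) (K : ℕ) {k : ℕ}
    (s : SeqOfRecord F ν M g K k) (hs : s.Ω k = Set.univ) :
    UbgMSOfRecord F N ν M g K k s = UbgOfRecord F N ν M g K k s := by
  funext W
  rw [UbgMSOfRecord_apply, UbgOfRecord_apply, regMSOfRecord_eq_regLFOfRecord_of_top ν hε K s.Ω hs]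

/-- … and so do their solvable sets. [cite: Balaban1988Convergent, (2.12) p.256 (bookkeeping)] -/
theorem solvableDom_regMSOfRecord_eq_of_top (ν : Stage7Numerics) (hε : 0 ≤ ν.εreg) (K : ℕ) {k : ℕ} (Ω : ℕ → Set (Site (F.P K) 0))
    (hΩ : Ω k = Set.univ) :
    solvableDom (avOfRecord F N K) (regMSOfRecord F N ν K k Ω) (genSet Ω k) =
      solvableDom (avOfRecord F N K) (regLFOfRecord F N ν K k) (genSet Ω k) := by
  rw [regMSOfRecord_eq_regLFOfRecord_of_top ν hε K Ω hΩ]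

/-- **At length `0` the two backgrounds of record COINCIDE** (same class, `regMSOfRecord_zero_eq`) — so node00-def-T's level-`0` pin by value
(`Record12.UbgOfRecord₁₂ … | 0 => fun _ 𝐖 => 𝐖 0`) composes with this file unchanged. [cite: Balaban1988Convergent, (2.12) p.256; Thm 1 p.262 (base)] -/
theorem UbgMSOfRecord_zero_eq_UbgOfRecord (ν : Stage7Numerics) (M : ℕ) (g : ℕ → ℝ) (K : ℕ) (s : SeqOfRecord F ν M g K 0) :
    UbgMSOfRecord F N ν M g K 0 s = UbgOfRecord F N ν M g K 0 s := by
  funext W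
  rw [UbgMSOfRecord_apply, UbgOfRecord_apply, regMSOfRecord_zero_eq ν K s.Ω]

/-! ## §4  The `Γ₀` clause in kernel (located defect №R16 and its repair) -/

/-- Two scale-`j` configurations agreeing on the four bonds of a plaquette have the same plaquette variable (bookkeeping).
[cite: Balaban1987RG1, (0.18) p.255 (bookkeeping)] -/
theorem plaqHol_eq_of_bond_eq {P : Params} {j : ℕ} {G : Type*} [GaugeGroup G] {U U' : GaugeField P j G} (p : Plaq P j)
    (h1 : U ⟨p.src, p.μ⟩ = U' ⟨p.src, p.μ⟩) (h2 : U ⟨p.src.shift p.μ, p.ν⟩ = U' ⟨p.src.shift p.μ, p.ν⟩)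
    (h3 : U ⟨p.src.shift p.ν, p.μ⟩ = U' ⟨p.src.shift p.ν, p.μ⟩) (h4 : U ⟨p.src, p.ν⟩ = U' ⟨p.src, p.ν⟩) :
    GaugeField.plaqHol U p = GaugeField.plaqHol U' p := by
  simp only [GaugeField.plaqHol, h1, h2, h3, h4]

/-- **`M⁰ = id` on `Γ₀ = Ω₁ᶜ`**: at positive length, a minimiser (in ANY class, along ANY averaging family whose `0`-fold iterate is the identity —
all of them) EQUALS `W₀` on every bond sourced in `Ω₁ᶜ` (r12 `gammaRegion_zero`, `pts_zero`). [cite: Balaban1988Convergent, (2.2) p.255, (2.10)–(2.12) p.256] -/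
theorem eq_W0_of_isMinimizer_genSet {P : Params} {G : Type*} [GaugeGroup G] (av : ∀ j, Averaging P j G) (reg : Set (GaugeField P 0 G))
    {k : ℕ} (hk : 0 < k) (Ω : ℕ → Set (Site P 0)) {W : MSField P G} {U₀ : GaugeField P 0 G}
    (h : IsMinimizer av reg (genSet Ω k) W U₀) (b : PBond P 0) (hb : b.src ∉ Ω 1) : U₀ b = W 0 b := by
  have hmem : b ∈ bondsOf (genSet Ω k 0) := by
    left
    show b.src ∈ pts 0 (gammaRegion Ω k 0)
    rw [gammaRegion_zero Ω hk, pts_zero]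
    exact hb
  simpa [avgFamily, Averaging.iter] using h.2.1 0 b hmem

/-- **LOCATED DEFECT №R16 (i), kernel**: in FILE 13's ONE-SCALE class, a datum whose `W₀` has a plaquette with three corners in `Ω₁ᶜ` of size
`≥ εreg·η_k²` is NOT in the solvable set of any positive-length determining set `genSet Ω k` — although print's class (1.7) only asks `< ε₀` there.
A settled negative edge about FILE 13's class, documented (FILE 13 stays as landed). [cite: Balaban1988Convergent, (2.10)–(2.12) p.256; Balaban1985RegularSpaces, (1.7) p.77] -/
theorem not_mem_solvableDom_regLF_of_le_plaq (ν : Stage7Numerics) {K k : ℕ} (hk : 0 < k) (Ω : ℕ → Set (Site (F.P K) 0))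
    (W : MSField (F.P K) (SU N)) (p : Plaq (F.P K) 0)
    (h₁ : p.src ∉ Ω 1) (h₂ : p.src.shift p.μ ∉ Ω 1) (h₃ : p.src.shift p.ν ∉ Ω 1)
    (hp : ν.εreg * (F.P K).eta k ^ 2 ≤ dist1 (GaugeField.plaqHol (W 0) p)) :
    W ∉ solvableDom (avOfRecord F N K) (regLFOfRecord F N ν K k) (genSet Ω k) := by
  rintro ⟨U₀, hU₀⟩
  have hb := eq_W0_of_isMinimizer_genSet (avOfRecord F N K) (regLFOfRecord F N ν K k) hk Ω hU₀
  have hhol : GaugeField.plaqHol U₀ p = GaugeField.plaqHol (W 0) p :=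
    plaqHol_eq_of_bond_eq p (hb _ h₁) (hb _ h₂) (hb _ h₃) (hb _ h₁)
  have hsmall : dist1 (GaugeField.plaqHol U₀ p) < ν.εreg * (F.P K).eta k ^ 2 := hU₀.1 p
  rw [hhol] at hsmall
  exact absurd hsmall (not_lt.mpr hp)

/-- **LOCATED DEFECT №R16 (ii), kernel**: hence FILE 13's background of record `UbgOfRecord … k s` of a positive-length sequence is the JUNK unit
configuration at every such datum. [cite: Balaban1988Convergent, (2.12) p.256 (typing convention)] -/
theorem UbgOfRecord_eq_one_of_le_plaq (ν : Stage7Numerics) (M : ℕ) (g : ℕ → ℝ) {K k : ℕ} (hk : 0 < k)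
    (s : SeqOfRecord F ν M g K k) (W : MSField (F.P K) (SU N)) (p : Plaq (F.P K) 0)
    (h₁ : p.src ∉ s.Ω 1) (h₂ : p.src.shift p.μ ∉ s.Ω 1) (h₃ : p.src.shift p.ν ∉ s.Ω 1)
    (hp : ν.εreg * (F.P K).eta k ^ 2 ≤ dist1 (GaugeField.plaqHol (W 0) p)) :
    UbgOfRecord F N ν M g K k s W = fun _ => 1 :=
  UbgOfRecord_of_not_mem ν M g K k s (not_mem_solvableDom_regLF_of_le_plaq ν hk s.Ω W p h₁ h₂ h₃ hp)

/-- **The repair's `Γ₀` clause**: in PRINT'S class, solvability at positive length forces on `W₀` only the scale-`0` bound `εreg·η₀²` (= `εreg`,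
print's `ε₀` of [15] (6)) at the plaquettes with three corners in `Ω₁ᶜ` — the necessary condition the class reads off `Γ₀`; print's data there are
`O(L²)ε₀(g)`-regular ([III] p.256) and `B₃ε₁ ≤ ε₀` ([15] Thm 1). [cite: Balaban1985RegularSpaces, (1.7) p.77 (j = 0); Balaban1985Variational, (7)–(8) p.278–279; Balaban1988Convergent, (2.10) p.256] -/
theorem dist1_W0_lt_of_mem_solvableDom_regMS (ν : Stage7Numerics) {K k : ℕ} (hk : 0 < k) (Ω : ℕ → Set (Site (F.P K) 0))
    {W : MSField (F.P K) (SU N)} (hW : W ∈ solvableDom (avOfRecord F N K) (regMSOfRecord F N ν K k Ω) (genSet Ω k))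
    (p : Plaq (F.P K) 0) (h₁ : p.src ∉ Ω 1) (h₂ : p.src.shift p.μ ∉ Ω 1) (h₃ : p.src.shift p.ν ∉ Ω 1) :
    dist1 (GaugeField.plaqHol (W 0) p) < ν.εreg * (F.P K).eta 0 ^ 2 := by
  obtain ⟨U₀, hU₀⟩ := hW
  have hb := eq_W0_of_isMinimizer_genSet (avOfRecord F N K) (regMSOfRecord F N ν K k Ω) hk Ω hU₀
  have hhol : GaugeField.plaqHol U₀ p = GaugeField.plaqHol (W 0) p :=
    plaqHol_eq_of_bond_eq p (hb _ h₁) (hb _ h₂) (hb _ h₃) (hb _ h₁)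
  rw [← hhol]
  exact plaqSmall_of_mem_regMSOfRecord hU₀.1 p

/-- The same contrast for FILE 13's class reads `εreg·η_k²` (solvable ⇒ `W₀` is `εreg·η_k²`-small there) — the located one-scale artefact.
[cite: Balaban1988Convergent, (2.12) p.256 (typing convention)] -/
theorem dist1_W0_lt_of_mem_solvableDom_regLF (ν : Stage7Numerics) {K k : ℕ} (hk : 0 < k) (Ω : ℕ → Set (Site (F.P K) 0))
    {W : MSField (F.P K) (SU N)} (hW : W ∈ solvableDom (avOfRecord F N K) (regLFOfRecord F N ν K k) (genSet Ω k))
    (p : Plaq (F.P K) 0) (h₁ : p.src ∉ Ω 1) (h₂ : p.src.shift p.μ ∉ Ω 1) (h₃ : p.src.shift p.ν ∉ Ω 1) :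
    dist1 (GaugeField.plaqHol (W 0) p) < ν.εreg * (F.P K).eta k ^ 2 := by
  by_contra h
  exact not_mem_solvableDom_regLF_of_le_plaq ν hk Ω W p h₁ h₂ h₃ (not_lt.mp h) hW

end Literature.MathematicalPhysics.QuantumFieldTheory.Balaban1983to89.Node00
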